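import Summits.QuantumFields.BalabanUV.T4Continuum.Support.BlockAverageVaryDisc
import Summits.QuantumFields.BalabanUV.T4Continuum.Support.NE9Lemma1RemainderPiece
import Summits.QuantumFields.BalabanUV.T4Continuum.Support.AveragingDeficitPlaqLin
import HarnessLib

/-!
# T⁴ programme, node NE3, row S6-Y7 (P3 leaf L7 «SLOP», part (a), ONE STEP) — file 3: THE ONE-STEP QUADRATIC REMAINDER
# OF BAŁABAN'S AVERAGE (42) UNDER `V ↦ V e^{tX}` AT A CURVED SMALL-FIELD BACKGROUND, RELATIVE TO THE TREE'S LINEARISATION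
# `pushDir` — B7 Prop. 3 (122)–(123) TYPE in local-sup and local-`ℓ²` form (`BlockAverageQuadRemainder`)

Cell `pub-balaban`, NE3 formalisation swarm (`t4/formal/NE3/LEAVES.md` row S5∕S6, sub-row S6-Y7; unit
`b2b-balaban-t4-ne3-formalise-leaf-10`, gen 2); sequel of `BlockAverageVaryHolo` ∕ `BlockAverageVaryDisc` (holomorphy of the relative chart
coordinate `relAvg L V X q κ σ = log(V̄(c)⁻¹·\overline{V e^{σX}}(c))` and its control `‖relAvg‖ ≤ 1∕2` on the disc
`‖σ‖ < rho0 d L ∕ s`).  THIS FILE: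
§1 THE LINEAR TERM IS THE TREE'S DIFFERENTIAL OF (42): `d/dt|₀ relAvg (t : ℂ) = pushDir L V X c`
(`AveragingDeficitSideDeriv.hasDerivAt_val_bavg_vary` + `AveragingDeficitChartCalculus.hasFDerivAt_mlog_one` BY NAME), hence
`deriv (relAvg L V X q κ) 0 = pushDir L V X q κ` (uniqueness of real derivatives);
§2 the order-two Taylor remainder of the tree's Schwarz toolkit, `taylorRem f 2 t = f t − f 0 − t • deriv f 0`
(`NE9Lemma1RemainderPiece`), and **THE ONE-STEP QUADRATIC REMAINDER BOUND**: for a `U(N)`-valued `V` with `SmallField V a`,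
`512(d+1)(d+4)L²a ≤ 1`, and `‖X(b)‖ ≤ s` on the bonds within `l¹`-distance `nbRad d L = 2dL + 2L` of `c₋ = q`,

  `‖log(V̄(c)⁻¹ · \overline{V e^{tX}}(c)) − t • pushDir L V X c‖ ≤ 2·(|t|·s ∕ rho0 d L)²`  for real `t`, `|t|·s ≤ rho0 d L ∕ 4`

(`norm_relLog_bavg_vary_sub_le`; `rho0 d L = 1∕(256(d+1)L)`, so the constant is `2∕rho0² = 131072·(d+1)²L²` against
`(|t|s)²`) — B7 Prop. 3 (122)–(123) TYPE ([Balaban1985Averaging] p. 36: «`Q(V₀, A) = L(Q(V₀)A) + C(V₀, A)`, `|C(V₀,A)| ≤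
C₁L²|A|²`») at a CURVED background, in the left-relative exponential chart, with the linear part identified BY NAME with row
NE3-R2's push-forward `pushDir` (the differential `D coord(0)` of `AveragingDeficitChartCalculus.fderiv_coord_apply`), by
holomorphy + Schwarz (`NE9Lemma1RemainderPiece.norm_taylorRem_le`, n = 2) instead of the (89)–(121) expansion;
§3 the local-`ℓ²` form: `sup ≤ ℓ²` on the `nbRad`-box, so the same bound holds with `s² := dirSq X (box (nbRad d L) q)`;
§4 the `ℓ¹∕ℓ²` dress over one period (`sum_period_norm_relLog_sub_le`): the sum over the coarse bonds `(L·y, κ)`,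
`y ∈ [0,M)^d`, against `dirSq X ([0,LM)^d)` with the torus multiplicity `d(2·nbRad+1)^d` of the contour neighbourhoods
(`AveragingDeficitPeriodicCounting.sum_periodBox_box_le`) — the shape road P3's L7(a) consumes, for ONE averaging step.
Since the hypotheses are stable under `V ↦ V e^{t₀X}` (small field with a slightly larger radius), the bound at every base
point `t₀` of a segment is the SAME theorem (road P3's (a′) ∕ `∂_t²` reading); no separate statement is made here.

HONEST FRAMING: finite-`T⁴` kinematics of ONE block-averaging step on ONE lattice (rung (B)+1 — NOT infinite volume, NOT
a mass gap, NOT Clay); no two lattice spacings are compared; the `k`-level statement of L7(a) (k-uniform constant over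
`avgIter`) is NOT proved here; nothing of NE3 is claimed (NE3-E stays CONDITIONAL on the co-owners' ⟨named structures⟩);
no `BetaPertH`, no (B), no G-an2-4; no printed sentence is a hypothesis ([cite:] tags are context).  PLACEMENT (human rule
2026-08-19): our work, under `Summits/QuantumFields/BalabanUV/`.
-/

set_option autoImplicit false

open scoped BigOperators Matrix.Norms.L2Operator Topology
open NormedSpace Finset Filter Metric

namespace Summit.QuantumFields.BalabanUV.T4Continuum.BlockAverageQuadRemainder

open Literature.MathematicalPhysics.QuantumFieldTheory.Balaban1983to89
open B7Prop1Explicit B7Prop2Explicit MatrixLog UnitaryModel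
open T4AveragingDeficitWall hiding Site Plane Plaq Bond
open AveragingDeficitResidualPairing (pushDir)
open AveragingDeficitSideDeriv (sideDeriv hasDerivAt_val_bavg_vary)
open AveragingDeficitChartCalculus (hasFDerivAt_mlog_one)
open T4AveragingDeficitWallBoundary (periodBox)
open AveragingDeficitPeriodicCounting (IsPeriodicDir)
open B11SchwarzRemainder (tail tail_zero tail_succ)
open NE9Lemma1RemainderPiece (taylorRem taylorHead norm_taylorRem_le)
open BlockAverageVaryHolo BlockAverageVaryDisc

noncomputable section

variable {d : ℕ} {n : Type*} [Fintype n] [DecidableEq n]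

/-! ## §1 The linear term is the tree's differential `pushDir` of (42) -/

/-- Along real parameters the relative chart coordinate of `BlockAverageVaryHolo` is
`t ↦ log(V̄(c)⁻¹ · \overline{V e^{tX}}(c))` with the tree's `vary`. [folklore] -/
theorem relAvg_ofReal (L : ℕ) (V : Site d → Fin d → (Matrix n n ℂ)ˣ) (X : Site d → Fin d → Matrix n n ℂ) (q : Site d)
    (κ : Fin d) (t : ℝ) :
    relAvg L V X q κ (t : ℂ)
      = mlog ((((bavg L V q κ)⁻¹ : (Matrix n n ℂ)ˣ) : Matrix n n ℂ) * ((bavg L (vary V X t) q κ : (Matrix n n ℂ)ˣ) : Matrix n n ℂ)) := by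
  rfl

/-- `pushDir = V̄(c)⁻¹ · (δV̄(c)·V̄(c))` (the tree's `Ad_{V̄⁻¹}` of the side derivative). [folklore] -/
theorem pushDir_eq (L : ℕ) (V : Site d → Fin d → (Matrix n n ℂ)ˣ) (X : Site d → Fin d → Matrix n n ℂ) (q : Site d)
    (κ : Fin d) :
    pushDir L V X q κ = (((bavg L V q κ)⁻¹ : (Matrix n n ℂ)ˣ) : Matrix n n ℂ)
      * (sideDeriv L V X q κ * ((bavg L V q κ : (Matrix n n ℂ)ˣ) : Matrix n n ℂ)) := by
  simp only [pushDir, Ad, inv_inv, mul_assoc]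

/-- **THE LINEAR TERM**: inside the ball of (21), `t ↦ log(V̄(c)⁻¹·\overline{V e^{tX}}(c))` has real derivative
`pushDir L V X c` at `t = 0` (`hasDerivAt_val_bavg_vary` ∘ left multiplication by the constant `V̄(c)⁻¹` ∘ `D log(1) = id`).
[folklore] -/
theorem hasDerivAt_relAvg_ofReal (L : ℕ) (V : Site d → Fin d → (Matrix n n ℂ)ˣ) (X : Site d → Fin d → Matrix n n ℂ)
    (q : Site d) (κ : Fin d)
    (hW : ∀ r : Fin d → Fin L, ‖((Wcx L V q κ (boxVec L r) : (Matrix n n ℂ)ˣ) : Matrix n n ℂ) - 1‖ < 1) :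
    HasDerivAt (fun t : ℝ => relAvg L V X q κ (t : ℂ)) (pushDir L V X q κ) 0 := by
  have h1 := (hasDerivAt_val_bavg_vary L V X q κ hW).const_mul ((((bavg L V q κ)⁻¹ : (Matrix n n ℂ)ˣ) : Matrix n n ℂ))
  have h2 : HasDerivAt (fun t : ℝ => relUnit L V X q κ (t : ℂ))
      ((((bavg L V q κ)⁻¹ : (Matrix n n ℂ)ˣ) : Matrix n n ℂ) * (sideDeriv L V X q κ * ((bavg L V q κ : (Matrix n n ℂ)ˣ) : Matrix n n ℂ))) 0 :=
    h1
  have h3 : HasFDerivAt (mlog : Matrix n n ℂ → Matrix n n ℂ) (ContinuousLinearMap.id ℂ (Matrix n n ℂ))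
      (relUnit L V X q κ ((0 : ℝ) : ℂ)) := by
    rw [Complex.ofReal_zero, relUnit_zero]
    exact hasFDerivAt_mlog_one
  have h4 := (h3.restrictScalars ℝ).comp_hasDerivAt (0 : ℝ) h2
  rw [← pushDir_eq] at h4
  exact h4

/-- **`deriv (relAvg L V X q κ) 0 = pushDir L V X q κ`** whenever the loop variables of `V` at `c` lie in the ball of (21)
(the complex derivative exists by holomorphy at `σ = 0` and restricts to the real one; real derivatives are unique).
[folklore] -/
theorem deriv_relAvg_zero (L : ℕ) (V : Site d → Fin d → (Matrix n n ℂ)ˣ) (X : Site d → Fin d → Matrix n n ℂ)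
    (q : Site d) (κ : Fin d)
    (hW : ∀ r : Fin d → Fin L, ‖((Wcx L V q κ (boxVec L r) : (Matrix n n ℂ)ˣ) : Matrix n n ℂ) - 1‖ < 1) :
    deriv (relAvg L V X q κ) 0 = pushDir L V X q κ := by
  have hA : AnalyticAt ℂ (relAvg L V X q κ) 0 :=
    analyticAt_relAvg V X 0 L q κ (by simpa only [cvary_zero] using hW)
      (by rw [relUnit_zero, sub_self, norm_zero]; exact one_pos)
  -- the complex derivative at `0`, restricted to the real line
  have h0 : HasDerivAt (relAvg L V X q κ) (deriv (relAvg L V X q κ) 0) ((0 : ℝ) : ℂ) := by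
    simpa using hA.differentiableAt.hasDerivAt
  have h1 := ((h0.hasFDerivAt.restrictScalars ℝ).comp (0 : ℝ) Complex.ofRealCLM.hasFDerivAt).hasDerivAt
  have h2 : ((ContinuousLinearMap.restrictScalars ℝ
      (ContinuousLinearMap.toSpanSingleton ℂ (deriv (relAvg L V X q κ) 0))).comp Complex.ofRealCLM) 1
        = deriv (relAvg L V X q κ) 0 := by simp
  rw [h2] at h1
  exact h1.unique (hasDerivAt_relAvg_ofReal L V X q κ hW)

/-! ## §2 The one-step quadratic remainder -/

/-- The order-two Taylor remainder of the tree's Schwarz toolkit, unfolded: `R₂f(t) = f(t) − f(0) − t·f′(0)`. [folklore] -/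
theorem taylorRem_two {F : Type*} [NormedAddCommGroup F] [NormedSpace ℂ F] (f : ℂ → F) (t : ℂ) :
    taylorRem f 2 t = f t - f 0 - t • deriv f 0 := by
  simp only [taylorRem, taylorHead, Finset.sum_range_succ, Finset.sum_range_zero, zero_add, pow_zero, one_smul,
    pow_one, tail_zero, tail_succ, dslope_same]
  abel

/-- THE BOUND ALONG THE COMPLEX PERTURBATION (`s > 0`): for `‖σ‖·s ≤ rho0 d L ∕ 2`,
`‖relAvg σ − σ • pushDir‖ ≤ 2·(‖σ‖s∕rho0)²` (Schwarz toolkit on the disc of `BlockAverageVaryHolo`, `M = 1∕2`, `n = 2`).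
[folklore] -/
theorem norm_relAvg_sub_smul_pushDir_le [Nonempty n] {L : ℕ} (hL : 1 ≤ L) {V : Site d → Fin d → (Matrix n n ℂ)ˣ}
    (hV : IsUnitaryCfg V) {a : ℝ} (ha : 0 ≤ a) (hsmall : 512 * (d + 1) * (d + 4) * (L : ℝ) ^ 2 * a ≤ 1)
    (hVa : SmallField V a) {X : Site d → Fin d → Matrix n n ℂ} {q : Site d} {s : ℝ} (hs : 0 < s)
    (hX : ∀ (x : Site d) (μ : Fin d), l1 (x - q) ≤ nbRad d L → ‖X x μ‖ ≤ s) (κ : Fin d) {σ : ℂ}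
    (hσ : ‖σ‖ * s ≤ rho0 d L / 2) :
    ‖relAvg L V X q κ σ - σ • pushDir L V X q κ‖ ≤ 2 * (‖σ‖ * s / rho0 d L) ^ 2 := by
  have hρ := rho0_pos (d := d) hL
  set R : ℝ := rho0 d L / s with hRdef
  have hR : 0 < R := div_pos hρ hs
  have hσR : σ ∈ ball (0 : ℂ) R := by
    rw [mem_ball_zero_iff, hRdef, lt_div_iff₀ hs]
    linarith
  have hdiff := differentiableOn_relAvg hL hV ha hsmall hVa hs hX κ
  have hM := norm_relAvg_le_of_mem_ball hL hV ha hsmall hVa hs hX κ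
  have h := norm_taylorRem_le (n := 2) hdiff hM hσR
  have hW : ∀ r : Fin d → Fin L, ‖((Wcx L V q κ (boxVec L r) : (Matrix n n ℂ)ˣ) : Matrix n n ℂ) - 1‖ < 1 := by
    have h0 := (norm_relUnit_sub_one_le hL hV ha hsmall hVa hX κ (σ := 0) (by simp)).1
    intro r
    have := h0 r
    rw [cvary_zero] at this
    linarith
  rw [taylorRem_two, relAvg_zero, sub_zero, deriv_relAvg_zero L V X q κ hW] at h
  have hRs : ‖σ‖ / R = ‖σ‖ * s / rho0 d L := by
    rw [hRdef]; field_simp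
  calc ‖relAvg L V X q κ σ - σ • pushDir L V X q κ‖ ≤ 2 ^ 2 * (1 / 2) * (‖σ‖ / R) ^ 2 := h
    _ = 2 * (‖σ‖ * s / rho0 d L) ^ 2 := by rw [hRs]; ring

/-- **THE ONE-STEP QUADRATIC REMAINDER OF THE AVERAGE (42) — B7 Prop. 3 (122)–(123) TYPE AT A CURVED BACKGROUND, local-sup
form.**  `V` `U(N)`-valued with `SmallField V a`, `512(d+1)(d+4)L²a ≤ 1`; `‖X(b)‖ ≤ s` (`s ≥ 0`) on the bonds within
`l¹`-distance `nbRad d L` of `c₋ = q`; `t` real with `|t|·s ≤ rho0 d L ∕ 4`.  Then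
`‖log(V̄(c)⁻¹·\overline{V e^{tX}}(c)) − t • pushDir L V X c‖ ≤ 2·(|t|s ∕ rho0 d L)²`.  (`s = 0` by a limit `s′ ↓ 0`.)
[folklore] -/
theorem norm_relLog_bavg_vary_sub_le [Nonempty n] {L : ℕ} (hL : 1 ≤ L) {V : Site d → Fin d → (Matrix n n ℂ)ˣ}
    (hV : IsUnitaryCfg V) {a : ℝ} (ha : 0 ≤ a) (hsmall : 512 * (d + 1) * (d + 4) * (L : ℝ) ^ 2 * a ≤ 1)
    (hVa : SmallField V a) {X : Site d → Fin d → Matrix n n ℂ} {q : Site d} {s : ℝ} (hs : 0 ≤ s)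
    (hX : ∀ (x : Site d) (μ : Fin d), l1 (x - q) ≤ nbRad d L → ‖X x μ‖ ≤ s) (κ : Fin d) {t : ℝ}
    (ht : |t| * s ≤ rho0 d L / 4) :
    ‖mlog ((((bavg L V q κ)⁻¹ : (Matrix n n ℂ)ˣ) : Matrix n n ℂ) * ((bavg L (vary V X t) q κ : (Matrix n n ℂ)ˣ) : Matrix n n ℂ))
        - t • pushDir L V X q κ‖ ≤ 2 * (|t| * s / rho0 d L) ^ 2 := by
  have hρ := rho0_pos (d := d) hL
  -- the bound for every `s′ > s` with `|t|·s′ ≤ rho0∕2`, then `s′ ↓ s`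
  have key : ∀ s' : ℝ, s < s' → |t| * s' ≤ rho0 d L / 2 →
      ‖mlog ((((bavg L V q κ)⁻¹ : (Matrix n n ℂ)ˣ) : Matrix n n ℂ) * ((bavg L (vary V X t) q κ : (Matrix n n ℂ)ˣ) : Matrix n n ℂ))
        - t • pushDir L V X q κ‖ ≤ 2 * (|t| * s' / rho0 d L) ^ 2 := by
    intro s' hs' ht'
    have hs'0 : 0 < s' := lt_of_le_of_lt hs hs'
    have hX' : ∀ (x : Site d) (μ : Fin d), l1 (x - q) ≤ nbRad d L → ‖X x μ‖ ≤ s' :=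
      fun x μ hx => (hX x μ hx).trans hs'.le
    have h := norm_relAvg_sub_smul_pushDir_le hL hV ha hsmall hVa hs'0 hX' κ (σ := (t : ℂ))
      (by rw [Complex.norm_real, Real.norm_eq_abs]; exact ht')
    rw [relAvg_ofReal, Complex.norm_real, Real.norm_eq_abs] at h
    simpa only [Complex.coe_smul] using h
  -- the limit `s′ ↓ s`
  have hlim : Tendsto (fun s' : ℝ => 2 * (|t| * s' / rho0 d L) ^ 2) (𝓝[>] s) (𝓝 (2 * (|t| * s / rho0 d L) ^ 2)) := by
    have hc : Continuous fun s' : ℝ => 2 * (|t| * s' / rho0 d L) ^ 2 := by continuity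
    exact (hc.tendsto s).mono_left nhdsWithin_le_nhds
  refine ge_of_tendsto hlim ?_
  -- eventually in `𝓝[>] s`: `s < s′` and `|t|·s′ ≤ rho0∕2`
  have hev : ∀ᶠ s' in 𝓝[>] s, |t| * s' ≤ rho0 d L / 2 := by
    have hc : ContinuousWithinAt (fun s' : ℝ => |t| * s') (Set.Ioi s) s :=
      (continuous_const.mul continuous_id).continuousWithinAt
    have hlt : |t| * s < rho0 d L / 2 := by linarith
    exact (hc.tendsto.eventually (gt_mem_nhds hlt)).mono fun s' h => h.le
  filter_upwards [hev, self_mem_nhdsWithin] with s' h1 h2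
  exact key s' h2 h1

/-! ## §3 The local-`ℓ²` form -/

/-- `sup ≤ ℓ²` on the box: `‖X(b)‖ ≤ √(dirSq X (box R q))` for every bond `b` starting in the `l¹`-ball of radius `R`.
[folklore] -/
theorem norm_le_sqrt_dirSq {R : ℕ} (X : Site d → Fin d → Matrix n n ℂ) {x q : Site d} (hx : l1 (x - q) ≤ R) (μ : Fin d) :
    ‖X x μ‖ ≤ Real.sqrt (dirSq X (box R q)) := by
  refine Real.le_sqrt_of_sq_le ?_
  unfold dirSq
  have h1 : ‖X x μ‖ ^ 2 ≤ ∑ κ : Fin d, ‖X x κ‖ ^ 2 :=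
    Finset.single_le_sum (f := fun κ => ‖X x κ‖ ^ 2) (fun _ _ => sq_nonneg _) (Finset.mem_univ μ)
  exact h1.trans (Finset.single_le_sum (f := fun y => ∑ κ : Fin d, ‖X y κ‖ ^ 2)
    (fun _ _ => Finset.sum_nonneg fun _ _ => sq_nonneg _) (AveragingDeficitPlaqLin.mem_box_of_l1 hx))

/-- **THE ONE-STEP QUADRATIC REMAINDER, local-`ℓ²` form**: with `S² = dirSq X (box (nbRad d L) q)` (the squares of `X` over
the `ℓ^∞` box of radius `nbRad d L` about `c₋`) and `|t|·S ≤ rho0 d L ∕ 4`,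
`‖log(V̄(c)⁻¹·\overline{V e^{tX}}(c)) − t • pushDir L V X c‖ ≤ (2∕rho0²)·t²·S²` — road P3's L7(a) at ONE bond of ONE
averaging step; summing over the coarse bonds of a period gives the `ℓ¹∕ℓ²` dress with a multiplicity `(2·nbRad+1)^d`.
[folklore] -/
theorem norm_relLog_bavg_vary_sub_le_dirSq [Nonempty n] {L : ℕ} (hL : 1 ≤ L) {V : Site d → Fin d → (Matrix n n ℂ)ˣ}
    (hV : IsUnitaryCfg V) {a : ℝ} (ha : 0 ≤ a) (hsmall : 512 * (d + 1) * (d + 4) * (L : ℝ) ^ 2 * a ≤ 1)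
    (hVa : SmallField V a) (X : Site d → Fin d → Matrix n n ℂ) (q : Site d) (κ : Fin d) {t : ℝ}
    (ht : |t| * Real.sqrt (dirSq X (box (nbRad d L) q)) ≤ rho0 d L / 4) :
    ‖mlog ((((bavg L V q κ)⁻¹ : (Matrix n n ℂ)ˣ) : Matrix n n ℂ) * ((bavg L (vary V X t) q κ : (Matrix n n ℂ)ˣ) : Matrix n n ℂ))
        - t • pushDir L V X q κ‖ ≤ 2 / rho0 d L ^ 2 * t ^ 2 * dirSq X (box (nbRad d L) q) := by
  have h := norm_relLog_bavg_vary_sub_le hL hV ha hsmall hVa (Real.sqrt_nonneg _)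
    (fun x μ hx => norm_le_sqrt_dirSq X hx μ) κ ht
  have hD : 0 ≤ dirSq X (box (nbRad d L) q) := by
    unfold dirSq; exact Finset.sum_nonneg fun _ _ => Finset.sum_nonneg fun _ _ => sq_nonneg _
  calc _ ≤ 2 * (|t| * Real.sqrt (dirSq X (box (nbRad d L) q)) / rho0 d L) ^ 2 := h
    _ = 2 / rho0 d L ^ 2 * t ^ 2 * dirSq X (box (nbRad d L) q) := by
        rw [div_pow, mul_pow, sq_abs, Real.sq_sqrt hD]; ring

/-! ## §4 The `ℓ¹∕ℓ²` dress over one period -/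

/-- `dirSq` over a box against the sup: `dirSq X (box R q) ≤ (2R+1)^d · d · s²` when `‖X(b)‖ ≤ s` everywhere. [folklore] -/
theorem dirSq_box_le_of_sup {R : ℕ} (X : Site d → Fin d → Matrix n n ℂ) (q : Site d) {s : ℝ}
    (hX : ∀ (x : Site d) (μ : Fin d), ‖X x μ‖ ≤ s) :
    dirSq X (box R q) ≤ (2 * R + 1) ^ d * (d * s ^ 2) := by
  unfold dirSq
  calc ∑ x ∈ box R q, ∑ κ : Fin d, ‖X x κ‖ ^ 2 ≤ ∑ x ∈ box R q, ∑ _κ : Fin d, s ^ 2 :=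
        Finset.sum_le_sum fun x _ => Finset.sum_le_sum fun κ _ =>
          pow_le_pow_left₀ (norm_nonneg _) (hX x κ) 2
    _ = (2 * R + 1) ^ d * (d * s ^ 2) := by
        rw [Finset.sum_const, Finset.sum_const, Finset.card_univ, Fintype.card_fin,
          AveragingDeficitCounting.card_box_eq]
        simp only [nsmul_eq_mul]
        push_cast; ring

/-- **THE ONE-STEP QUADRATIC REMAINDER, `ℓ¹∕ℓ²` DRESS OVER ONE PERIOD** (road P3's L7(a) for ONE averaging step): for a
`U(N)`-valued `V` with `SmallField V a`, `512(d+1)(d+4)L²a ≤ 1`, an `LM`-periodic direction `X` with `‖X(b)‖ ≤ s`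
everywhere, and real `t` with `|t|·s·√(d(2·nbRad+1)^d) ≤ rho0 d L ∕ 4`, the sum over the coarse bonds `c = (L·y, κ)`,
`y ∈ [0,M)^d`, of `‖log(V̄(c)⁻¹·\overline{V e^{tX}}(c)) − t • pushDir L V X c‖` is at most
`(2∕rho0²)·t²·d(2·nbRad+1)^d · dirSq X ([0,LM)^d)` — the `ℓ¹` norm of the quadratic remainder on the coarse unit lattice
against the UNWEIGHTED `ℓ²` norm of `X` on the fine lattice, constant depending on `d, L` only
(`AveragingDeficitPeriodicCounting.sum_periodBox_box_le` for the multiplicity of the contour neighbourhoods). [folklore] -/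
theorem sum_period_norm_relLog_sub_le [Nonempty n] {L M : ℕ} (hL : 1 ≤ L) (hM : 1 ≤ M)
    {V : Site d → Fin d → (Matrix n n ℂ)ˣ} (hV : IsUnitaryCfg V) {a : ℝ} (ha : 0 ≤ a)
    (hsmall : 512 * (d + 1) * (d + 4) * (L : ℝ) ^ 2 * a ≤ 1) (hVa : SmallField V a)
    {X : Site d → Fin d → Matrix n n ℂ} (hXp : IsPeriodicDir X ((L : ℤ) * M)) {s : ℝ} (hs : 0 ≤ s)
    (hX : ∀ (x : Site d) (μ : Fin d), ‖X x μ‖ ≤ s) {t : ℝ}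
    (ht : |t| * (s * Real.sqrt (d * (2 * nbRad d L + 1) ^ d)) ≤ rho0 d L / 4) :
    ∑ y ∈ periodBox M, ∑ κ : Fin d,
        ‖mlog ((((bavg L V ((L : ℤ) • y) κ)⁻¹ : (Matrix n n ℂ)ˣ) : Matrix n n ℂ)
            * ((bavg L (vary V X t) ((L : ℤ) • y) κ : (Matrix n n ℂ)ˣ) : Matrix n n ℂ)) - t • pushDir L V X ((L : ℤ) • y) κ‖
      ≤ 2 / rho0 d L ^ 2 * t ^ 2 * (d * (2 * nbRad d L + 1) ^ d) * dirSq X (periodBox (L * M)) := by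
  -- local ℓ² against the sup
  have hbox : ∀ y : Site d, Real.sqrt (dirSq X (box (nbRad d L) ((L : ℤ) • y)))
      ≤ s * Real.sqrt (d * (2 * nbRad d L + 1) ^ d) := by
    intro y
    have h := dirSq_box_le_of_sup (R := nbRad d L) X ((L : ℤ) • y) hX
    calc Real.sqrt (dirSq X (box (nbRad d L) ((L : ℤ) • y)))
        ≤ Real.sqrt ((2 * nbRad d L + 1) ^ d * (d * s ^ 2)) := Real.sqrt_le_sqrt h
      _ = Real.sqrt ((d * (2 * nbRad d L + 1) ^ d) * s ^ 2) := by congr 1; ring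
      _ = s * Real.sqrt (d * (2 * nbRad d L + 1) ^ d) := by
          rw [Real.sqrt_mul' _ (sq_nonneg s), Real.sqrt_sq hs, mul_comm]
  have hty : ∀ y : Site d, |t| * Real.sqrt (dirSq X (box (nbRad d L) ((L : ℤ) • y))) ≤ rho0 d L / 4 := fun y =>
    (mul_le_mul_of_nonneg_left (hbox y) (abs_nonneg t)).trans ht
  -- the torus multiplicity of the contour neighbourhoods
  have hper : ∑ y ∈ periodBox M, dirSq X (box (nbRad d L) ((L : ℤ) • y))
      ≤ (2 * nbRad d L + 1) ^ d * dirSq X (periodBox (L * M)) := by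
    unfold dirSq
    refine AveragingDeficitPeriodicCounting.sum_periodBox_box_le L M hL hM (nbRad d L)
      (fun _ => Finset.sum_nonneg fun _ _ => sq_nonneg _) fun x κ => ?_
    rw [AveragingDeficitPeriodicCounting.natCast_mul_period]
    exact Finset.sum_congr rfl fun μ _ => by rw [hXp x κ μ]
  have hC : 0 ≤ 2 / rho0 d L ^ 2 * t ^ 2 * (d : ℝ) := by positivity
  calc ∑ y ∈ periodBox M, ∑ κ : Fin d,
        ‖mlog ((((bavg L V ((L : ℤ) • y) κ)⁻¹ : (Matrix n n ℂ)ˣ) : Matrix n n ℂ)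
            * ((bavg L (vary V X t) ((L : ℤ) • y) κ : (Matrix n n ℂ)ˣ) : Matrix n n ℂ)) - t • pushDir L V X ((L : ℤ) • y) κ‖
      ≤ ∑ y ∈ periodBox M, ∑ _κ : Fin d, 2 / rho0 d L ^ 2 * t ^ 2 * dirSq X (box (nbRad d L) ((L : ℤ) • y)) :=
        Finset.sum_le_sum fun y _ => Finset.sum_le_sum fun κ _ =>
          norm_relLog_bavg_vary_sub_le_dirSq hL hV ha hsmall hVa X ((L : ℤ) • y) κ (hty y)
    _ = 2 / rho0 d L ^ 2 * t ^ 2 * d * ∑ y ∈ periodBox M, dirSq X (box (nbRad d L) ((L : ℤ) • y)) := by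
        rw [Finset.mul_sum]
        refine Finset.sum_congr rfl fun y _ => ?_
        rw [Finset.sum_const, Finset.card_univ, Fintype.card_fin, nsmul_eq_mul]
        ring
    _ ≤ 2 / rho0 d L ^ 2 * t ^ 2 * d * ((2 * nbRad d L + 1) ^ d * dirSq X (periodBox (L * M))) :=
        mul_le_mul_of_nonneg_left hper hC
    _ = 2 / rho0 d L ^ 2 * t ^ 2 * (d * (2 * nbRad d L + 1) ^ d) * dirSq X (periodBox (L * M)) := by ring

end

end Summit.QuantumFields.BalabanUV.T4Continuum.BlockAverageQuadRemainder
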